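import Literature.AlgebraicGeometry.HodgeTheory.QuaternionicQuarticPrimeSpecialisation
import Literature.AlgebraicGeometry.Motives.HypersurfaceFundamentalClass
import Literature.AlgebraicGeometry.Motives.BettiCycleClassProofs
import Mathlib.AlgebraicGeometry.Geometrically.Irreducible
import Mathlib.RingTheory.LocalProperties.Reduced
import Mathlib.RingTheory.Localization.BaseChange
import HarnessLib

/-!
# The generic fibre of the universal quaternionic quartic is integral, projective, geometrically irreducible, of dimension 2

Layer `Literature/AlgebraicGeometry/HodgeTheory`. THEOREMS (plus the plumbing abbreviation
`coverGen` — the generic fibre as a `K`-scheme — and its embedding `coverGenEmb`); no named fact. Written by the prover seat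
`hodge-nonav-19716-p2` (g13, cell `hodge-nonav`) as brick **QF-1b «COVER», clause (C2)** of prover-Bx's programme
Q-FAMILY (memo `PROGRAMME-Q-FAMILY-Bx-g18.md` §6–§7) for route `HodgeConjecture/Q8SymplecticPowers` (crux K1Q,
stmt-HodgeConjecture-24190): the hypotheses `[IsIntegral X.left]`, `IsProjectiveOver X`, `[GeometricallyIrreducible X.hom]`
of QF-4 `Resolution.exists_isResolution_smooth_geometricallyIrreducible` for `X = 𝒱_K`, and the dimension `2`.

With `A = ParamRing e`, `K = Frac A` (any `[IsFractionRing A K]`), `𝒱 = cover e` (`QuaternionicQuarticCover`):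

* `isReduced_pullback_specMap_of_isLocalization` — GENERAL: for `X → Spec A` with `X` reduced and `A → A_M` a
  localization, `X ×_A Spec A_M` is reduced (affine-locally `Γ(U) ⊗_A A_M` is a localization of the reduced
  `Γ(U)`: Mathlib `IsLocalization.tensor`, `isReduced_localizationPreserves`; Atiyah–Macdonald Cor. 3.12).
* (from `QuaternionicQuarticPrimeSpecialisation`: `prime_map_univQ_of_injective` — `φ(Q_e)` is prime at every
  injective field-valued point `φ : A ↪ L`, `e ≥ 2`.)
* `fiberSch e φ := Over.mk (𝒱 ×_A Spec L → Spec L)` — the fibre over a ring-valued point `φ : A → L` as an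
  `L`-scheme; over a field: `fiberSchEmb e φ : fiberSch e φ ⟶ projectiveSpace 3 L` (closed immersion onto `V₊(Q_φ)`,
  `range_fiberSchEmb`), **`isProjectiveOver_fiberSch`**;
* the generic fibre `coverGen e K := fiberSch e (algebraMap A K)` (`= Over.mk (snd (cover e) (specOver A K)).left`
  by `rfl`, `coverGen_eq_tensor`): `isReduced_coverGen_left`, `irreducibleSpace_coverGen_left`,
  **`isIntegral_coverGen_left`**; `coverGenEmb`, `range_coverGenEmb`, **`isProjectiveOver_coverGen`**; **`geometricallyIrreducible_coverGen_hom`**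
  (base change to `L ⊇ K` is the fibre over the injective point `A → K → L`); **`height_genericPoint_coverGen`**
  (`= 2`, `Hypersurface.height_genericPoint_of_irreducible`) and `topologicalKrullDim_coverGen` (`= 2`).
  Also `irreducibleSpace_fiber_of_genericity` (any field point of `D(G_e)`, e.g. a complex point of the good
  open) and `irreducibleSpace_fiber_of_injective` (any injective field point).

Honest scope: scheme bookkeeping for one explicit family of quartic surfaces; nothing here bears on HC. The
complex-point fibres (clause (C3)) are the companion file `QuaternionicQuarticCoverFibres`.

## References

* [AtiyahMacdonald1969] M. Atiyah, I. Macdonald, Introduction to Commutative Algebra (1969), Cor. 3.12.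
* [Lang2002] S. Lang, Algebra, 3rd ed. (2002), Ch. IV §1, §3 (evaluation; Eisenstein).
* [Hartshorne1977] R. Hartshorne, Algebraic Geometry (1977): I §2, II Ex. 2.9, II Ex. 3.11, II §4.
* [GortzWedhorn2020] U. Görtz, T. Wedhorn, Algebraic Geometry I, 2nd ed. (2020), Prop. 3.27.
* [StacksProject] The Stacks Project, Tag 0366 (geometrically irreducible).
* [Fulton1998] W. Fulton, Intersection Theory, 2nd ed. (1998), Example 1.9.3 (dimension of a hypersurface).
* [EGAIV3] EGA IV₃ (1966), §8 (generic fibre / spreading out).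
* [Kollar2007] J. Kollár, Lectures on Resolution of Singularities (2007), §3.3.
-/


noncomputable section

open CategoryTheory AlgebraicGeometry MvPolynomial Limits TopologicalSpace TensorProduct
open Literature.AlgebraicGeometry.Motives Literature.AlgebraicGeometry.Motives.UniversalHypersurface

universe u

namespace Literature.AlgebraicGeometry.HodgeTheory.Q8Family

/-! ### Base change of a reduced scheme to a localization of the base ring is reduced -/

section Reduced

/-- **`X ×_A Spec A_M` is reduced for `X` reduced over `Spec A`** and `A → A_M` a localization: it is covered
by the spectra of the localizations `Γ(U, 𝒪_X) ⊗_A A_M = Γ(U, 𝒪_X)_M` of the reduced rings of affine opens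
`U ⊆ X` (Mathlib `IsLocalization.tensor`, `isReduced_localizationPreserves`), and reducedness is local.
[cite: AtiyahMacdonald1969, Cor. 3.12 (localization commutes with the nilradical)] -/
theorem isReduced_pullback_specMap_of_isLocalization {A K : Type u} [CommRing A] [CommRing K]
    [Algebra A K] (M : Submonoid A) [IsLocalization M K] {X : Scheme.{u}} (f : X ⟶ Spec (.of A))
    [IsReduced X] : IsReduced (pullback f (Spec.map (CommRingCat.ofHom (algebraMap A K)))) := by
  let g := Spec.map (CommRingCat.ofHom (algebraMap A K))
  let 𝒰 := Scheme.Pullback.openCoverOfLeft X.affineOpenCover.openCover f g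
  haveI : ∀ i, IsReduced (𝒰.X i) := fun i => by
    -- the piece is `Spec Rᵢ ×_A Spec K` for the affine open `Spec Rᵢ → X`
    change IsReduced (pullback (X.affineOpenCover.f i ≫ f) g)
    set R : CommRingCat := X.affineOpenCover.X i with hR
    haveI : IsReduced (Spec R) := isReduced_of_isOpenImmersion (X.affineOpenCover.f i)
    haveI : _root_.IsReduced R := (affine_isReduced_iff R).mp inferInstance
    let α : CommRingCat.of A ⟶ R := Spec.preimage (X.affineOpenCover.f i ≫ f)
    letI : Algebra A R := α.hom.toAlgebra
    have hα : X.affineOpenCover.f i ≫ f = Spec.map (CommRingCat.ofHom (algebraMap A R)) := by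
      rw [RingHom.algebraMap_toAlgebra, CommRingCat.ofHom_hom, Spec.map_preimage]
    haveI : IsLocalization (Algebra.algebraMapSubmonoid R M) (R ⊗[A] K) := IsLocalization.tensor K M
    haveI : _root_.IsReduced (R ⊗[A] K) :=
      isReduced_localizationPreserves (Algebra.algebraMapSubmonoid R M) (R ⊗[A] K) inferInstance
    haveI : IsReduced (Spec (.of (R ⊗[A] K))) := inferInstance
    let e : pullback (X.affineOpenCover.f i ≫ f) g ≅ Spec (.of (R ⊗[A] K)) :=
      pullback.congrHom hα rfl ≪≫ pullbackSpecIso A R K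
    exact isReduced_of_isOpenImmersion e.hom
  exact IsReduced.of_openCover (𝒰 := 𝒰)

end Reduced

/-! ### The generic fibre `𝒱_K = 𝒱 ×_A Spec K`, `K = Frac A` -/

section GenericFibre

variable (e : ℕ) (K : Type) [Field K] [Algebra (ParamRing e) K]

attribute [local instance] MvPolynomial.gradedAlgebra

/-- **The fibre `𝒱_φ → Spec L` over a ring-valued point `φ : A → L` as an `L`-scheme**: `Over.mk` of the
projection `𝒱 ×_A Spec L → Spec L`. [cite: EGAIV3, §8] -/
abbrev fiberSch {L : Type} [CommRing L] (φ : ParamRing e →+* L) : SchemeOver L :=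
  Over.mk (pullback.snd (cover e).hom (Spec.map (CommRingCat.ofHom φ)))

/-- **The closed `L`-immersion `𝒱_φ ↪ ℙ³_L`** (`fiberEmb` over `Spec L`, as a morphism of `L`-schemes; `L` a field).
[cite: Hartshorne1977, II Ex. 3.11 (a)] -/
def fiberSchEmb {L : Type} [Field L] (φ : ParamRing e →+* L) : fiberSch e φ ⟶ projectiveSpace 3 L :=
  Over.homMk (fiberEmb e φ) (fiberEmb_comp_projSpToSpec e φ)

/-- `fiberSchEmb` is `fiberEmb` on underlying schemes (`rfl`). [cite: Hartshorne1977, II Ex. 3.11 (a)] -/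
@[simp]
theorem fiberSchEmb_left {L : Type} [Field L] (φ : ParamRing e →+* L) : (fiberSchEmb e φ).left = fiberEmb e φ := rfl

/-- `𝒱_φ ↪ ℙ³_L` is a closed immersion. [cite: Hartshorne1977, II Ex. 3.11 (a)] -/
instance isClosedImmersion_fiberSchEmb_left {L : Type} [Field L] (φ : ParamRing e →+* L) :
    IsClosedImmersion (fiberSchEmb e φ).left :=
  isClosedImmersion_fiberEmb e φ

/-- The image of `𝒱_φ ↪ ℙ³_L` is `V₊(Q_φ)`. [cite: Hartshorne1977, II Ex. 3.11 (a)] -/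
theorem range_fiberSchEmb {L : Type} [Field L] (φ : ParamRing e →+* L) :
    Set.range (fiberSchEmb e φ).left =
      ProjectiveSpectrum.zeroLocus (homogeneousSubmodule (Fin (2 + 2)) L) {MvPolynomial.map φ (univQ e)} :=
  range_fiberEmb e φ

/-- **Every field fibre `𝒱_φ` is projective over `L`.** [cite: Hartshorne1977, II §4 (definition of projective morphisms, p. 103)] -/
theorem isProjectiveOver_fiberSch {L : Type} [Field L] (φ : ParamRing e →+* L) : IsProjectiveOver (fiberSch e φ) :=
  ⟨3, fiberSchEmb e φ, inferInstance⟩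

/-- **The generic fibre `𝒱_K → Spec K` as a `K`-scheme** (`K = Frac A`): the fibre over `algebraMap A K`.
On the nose this is `Over.mk (snd (cover e) (specOver A K)).left` of the `Limits.LocApprox` currency
(`Over.tensorObj_left`, `Over.snd_left` are `rfl`). [cite: EGAIV3, §8] -/
abbrev coverGen : SchemeOver K := fiberSch e (algebraMap (ParamRing e) K)

/-- `coverGen` is the `K`-scheme underlying `cover e ⊗ specOver A K` (`rfl`). [cite: EGAIV3, §8] -/
theorem coverGen_eq_tensor :
    coverGen e K = Over.mk (CartesianMonoidalCategory.snd (cover e) (specOver (ParamRing e) K)).left := rfl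

/-- The closed `K`-immersion `𝒱_K ↪ ℙ³_K`. [cite: Hartshorne1977, II Ex. 3.11 (a)] -/
abbrev coverGenEmb : coverGen e K ⟶ projectiveSpace 3 K := fiberSchEmb e (algebraMap (ParamRing e) K)

/-- The image of `𝒱_K ↪ ℙ³_K` is `V₊(Q_K)`. [cite: Hartshorne1977, II Ex. 3.11 (a)] -/
theorem range_coverGenEmb :
    Set.range (coverGenEmb e K).left =
      ProjectiveSpectrum.zeroLocus (homogeneousSubmodule (Fin (2 + 2)) K)
        {MvPolynomial.map (algebraMap (ParamRing e) K) (univQ e)} :=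
  range_fiberEmb e _

/-- **The generic fibre is projective over `K`.** [cite: Hartshorne1977, II §4 (definition of projective morphisms, p. 103)] -/
theorem isProjectiveOver_coverGen : IsProjectiveOver (coverGen e K) :=
  isProjectiveOver_fiberSch e _

variable [IsFractionRing (ParamRing e) K]

/-- `A → K → L` is injective for every field `L` over `K = Frac A`. [cite: Lang2002, Ch. II §4 (the quotient field of an entire ring embeds it)] -/
theorem algebraMap_comp_injective {L : Type} [Field L] [Algebra K L] :
    Function.Injective ((algebraMap K L).comp (algebraMap (ParamRing e) K)) :=
  (algebraMap K L).injective.comp (IsFractionRing.injective (ParamRing e) K)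

/-- **The generic fibre is reduced** (`𝒱` is reduced and `A → K` is a localization). [cite: AtiyahMacdonald1969, Cor. 3.12 (localization commutes with the nilradical)] -/
instance isReduced_coverGen_left : IsReduced (coverGen e K).left :=
  isReduced_pullback_specMap_of_isLocalization (nonZeroDivisors (ParamRing e)) (cover e).hom

/-- **The fibre over an injective field-valued point is irreducible** (`e ≥ 2`): the specialised form is
prime (`prime_map_univQ_of_injective`) and `irreducibleSpace_fiber`. [cite: Hartshorne1977, II Ex. 2.9] -/
theorem irreducibleSpace_fiber_of_injective {L : Type} [Field L] (φ : ParamRing e →+* L)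
    (hφ : Function.Injective φ) (he : 2 ≤ e) :
    IrreducibleSpace ↑(pullback (cover e).hom (Spec.map (CommRingCat.ofHom φ))) :=
  irreducibleSpace_fiber e φ (by omega) (prime_map_univQ_of_injective φ hφ he)

/-- **The fibre over a point of `D(G_e)` is irreducible** (`e ≥ 1`; any field-valued point `φ` with
`φ(G_e) ≠ 0`, e.g. a complex point of the good open). [cite: Hartshorne1977, II Ex. 2.9] -/
theorem irreducibleSpace_fiber_of_genericity {L : Type} [Field L] (φ : ParamRing e →+* L) (he : 1 ≤ e)
    (hG : φ (genericityElem e) ≠ 0) :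
    IrreducibleSpace ↑(pullback (cover e).hom (Spec.map (CommRingCat.ofHom φ))) :=
  irreducibleSpace_fiber e φ he (prime_map_univQ_of_genericity φ hG)

/-- The generic fibre is irreducible (`e ≥ 2`). [cite: Hartshorne1977, II Ex. 2.9] -/
theorem irreducibleSpace_coverGen_left (he : 2 ≤ e) : IrreducibleSpace ↑(coverGen e K).left :=
  irreducibleSpace_fiber_of_injective e (algebraMap (ParamRing e) K) (IsFractionRing.injective _ _) he

/-- **The generic fibre `𝒱_K` is integral** (`e ≥ 2`): reduced and irreducible. [cite: GortzWedhorn2020, Prop. 3.27] -/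
theorem isIntegral_coverGen_left (he : 2 ≤ e) : IsIntegral (coverGen e K).left :=
  haveI := irreducibleSpace_coverGen_left e K he
  isIntegral_of_irreducibleSpace_of_isReduced _

/-- **The generic fibre is geometrically irreducible** (`e ≥ 2`): its base change to a field `L ⊇ K` is the
fibre `𝒱 ×_A Spec L` over the injective point `A → K → L`, irreducible by `irreducibleSpace_fiber_of_injective`.
[cite: StacksProject, Tag 0366] -/
theorem geometricallyIrreducible_coverGen_hom (he : 2 ≤ e) : GeometricallyIrreducible (coverGen e K).hom := by
  rw [geometricallyIrreducible_iff, geometrically_iff_of_commRing]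
  intro L _ _ Y fst snd hsq
  set jK := Spec.map (CommRingCat.ofHom (algebraMap (ParamRing e) K)) with hjK
  set jKL := Spec.map (CommRingCat.ofHom (algebraMap K L)) with hjKL
  -- `Y = 𝒱 ×_A Spec L` over the composite point
  have sqK : IsPullback (pullback.fst (cover e).hom jK) (pullback.snd (cover e).hom jK) (cover e).hom jK :=
    IsPullback.of_hasPullback _ _
  have big : IsPullback (fst ≫ pullback.fst (cover e).hom jK) snd (cover e).hom (jKL ≫ jK) :=
    (hsq.flip.paste_vert sqK.flip).flip
  have hcomp : jKL ≫ jK =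
      Spec.map (CommRingCat.ofHom ((algebraMap K L).comp (algebraMap (ParamRing e) K))) := by
    rw [hjKL, hjK, ← Spec.map_comp, ← CommRingCat.ofHom_comp]
  haveI : IrreducibleSpace ↑(pullback (cover e).hom
      (Spec.map (CommRingCat.ofHom ((algebraMap K L).comp (algebraMap (ParamRing e) K))))) :=
    irreducibleSpace_fiber_of_injective e _ (algebraMap_comp_injective e K) he
  have iso : Y ≅ pullback (cover e).hom
      (Spec.map (CommRingCat.ofHom ((algebraMap K L).comp (algebraMap (ParamRing e) K)))) :=
    big.isoPullback ≪≫ pullback.congrHom rfl hcomp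
  exact iso.hom.homeomorph.irreducibleSpace_iff.mpr inferInstance

/-- **The generic fibre has dimension 2**: the generic point of the integral `𝒱_K ≅ V₊(Q_K) ⊂ ℙ³_K` has height
`2` in the specialisation order (`Hypersurface.height_genericPoint_of_irreducible`; `e ≥ 2`).
[cite: Fulton1998, Example 1.9.3 (p. 23)] -/
theorem height_genericPoint_coverGen (he : 2 ≤ e) :
    haveI := irreducibleSpace_coverGen_left e K he
    Order.height (genericPoint ↑(coverGen e K).left) = 2 := by
  haveI := isIntegral_coverGen_left e K he
  exact Hypersurface.height_genericPoint_of_irreducible (d := 2) (coverGenEmb e K)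
    ((isHomogeneous_univQ e (by omega)).map (algebraMap (ParamRing e) K))
    (prime_map_univQ_of_injective (algebraMap (ParamRing e) K) (IsFractionRing.injective _ _) he).irreducible
    (range_coverGenEmb e K)

/-- The same in the currency `topologicalKrullDim = 2` (`Scheme.height_genericPoint`). [cite: Fulton1998, Example 1.9.3 (p. 23)] -/
theorem topologicalKrullDim_coverGen (he : 2 ≤ e) : topologicalKrullDim ↑(coverGen e K).left = 2 := by
  haveI := irreducibleSpace_coverGen_left e K he
  rw [← Scheme.height_genericPoint, height_genericPoint_coverGen e K he]
  rfl

end GenericFibre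

end Literature.AlgebraicGeometry.HodgeTheory.Q8Family

end
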